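import Summits.BirchSwinnertonDyer.Uniform.U2.GenusPointRingClass
import Literature.NumberTheory.EllipticCurves.RingClassFieldTower
import HarnessLib

/-!
# Cell «bsd-uniform», track U2, route C — the RESTRICTION API between ring class fields:
# `Gal(K[n]/K) → Gal(K[m]/K)` for `m ∣ n`, and its compatibility with the Galois action on points
# (the glue u2-lit's ANSWER L-C1 asks for, so that one-step trace relations printed at different top
# fields `K[mq]` can be folded along `K ⊂ K[1] ⊂ K[q₁] ⊂ … ⊂ K[M]`)

HONEST FRAMING (cell «bsd-uniform», run/shared/lean/pub/bsd-uniform/, seat u2-p3): field-theoretic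
PLUMBING over the tree's concrete ring class fields `K[n] = ringClassField K ι n ⊂ ℂ`; no claim about
the Birch–Swinnerton-Dyer conjecture, no arithmetic fact asserted. Inputs, all tree THEOREMS:
`ringClassField_mono` (`K[m] ⊆ K[n]` for `m ∣ n`; `RingClassFieldTower.lean`), `RingClassField.inclusion`
(`K[m] →ₐ[K] K[n]`, the identity on complex numbers), `finiteDimensional_and_isGalois_ringClassField`
(`K[m]/K` Galois, hence normal), Mathlib's `AlgEquiv.restrictNormal`.

## Contents

* `algEquivOfMem ι n σ` — an element of `𝒢_n = ringClassGal ι n` as a `K`-algebra automorphism of `K[n]`.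
* `restrictGal hK ι hmn hn σ ∈ ringClassGal ι m` — its restriction to `K[m]` (`m ∣ n`, `n ≠ 0`), and
  `coe_restrictGal_apply`: `((restrictGal σ) x : ℂ) = (σ (inclusion x) : ℂ)` — restriction is "the same
  map on complex numbers".
* `map_inclusion_pointGalHom_restrictGal`: on points, `incl (res σ · P) = σ · (incl P)` in `E(K[n])` for
  `P ∈ E(K[m])` — the compatibility that transports a trace identity from `E(K[m])` to `E(K[n])`.
-/

noncomputable section

open scoped Classical

open WeierstrassCurve NumberField Literature.NumberTheory.EllipticCurves
  Literature.NumberTheory.EllipticCurves.ModularForms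

set_option autoImplicit false

namespace Summit.BirchSwinnertonDyer.Uniform.U2.RingClass

variable {K : Type} [Field K] [NumberField K] (ι : K →+* ℂ)

/-- An element of `𝒢_n = Gal(K[n]/K)` (a `ℚ`-algebra automorphism of `K[n]` fixing `ι(K)`) as a
`K`-algebra automorphism. [folklore] -/
def algEquivOfMem (n : ℕ) (σ : ringClassGal ι n) :
    ringClassField K ι n ≃ₐ[K] ringClassField K ι n :=
  { (σ.1 : ringClassField K ι n ≃ₐ[ℚ] ringClassField K ι n) with
    commutes' := fun k => smul_algebraMap_of_mem_ringClassGal σ.2 k }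

/-- `algEquivOfMem` acts as `σ`. [folklore] -/
@[simp]
theorem algEquivOfMem_apply (n : ℕ) (σ : ringClassGal ι n) (x : ringClassField K ι n) :
    algEquivOfMem ι n σ x = σ.1 x := rfl

section Restrict

variable (hK : IsImaginaryQuadratic K) {m n : ℕ} (hmn : m ∣ n) (hn : n ≠ 0)

include hmn hn in
/-- `m ≠ 0` when `m ∣ n` and `n ≠ 0`. [folklore] -/
theorem ne_zero_of_dvd : m ≠ 0 := by
  rintro rfl
  exact hn (Nat.eq_zero_of_zero_dvd hmn)

/-- **Restriction `Gal(K[n]/K) → Gal(K[m]/K)` for `m ∣ n`**: restrict the `K`-automorphism `σ` of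
`K[n]` to the normal subextension `K[m] ⊆ K[n]` (`ringClassField_mono`; `K[m]/K` is Galois by
`finiteDimensional_and_isGalois_ringClassField`) via Mathlib's `AlgEquiv.restrictNormal`, and view the
result as an element of `ringClassGal ι m`. [folklore] -/
def restrictGal (σ : ringClassGal ι n) : ringClassGal ι m :=
  letI : Algebra (ringClassField K ι m) (ringClassField K ι n) :=
    (RingClassField.inclusion ι (ringClassField_mono hK ι hmn hn)).toRingHom.toAlgebra
  haveI : IsScalarTower K (ringClassField K ι m) (ringClassField K ι n) :=
    IsScalarTower.of_algebraMap_eq fun k =>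
      ((RingClassField.inclusion ι (ringClassField_mono hK ι hmn hn)).commutes k).symm
  haveI := (finiteDimensional_and_isGalois_ringClassField hK ι (ne_zero_of_dvd hmn hn)).2
  ⟨((algEquivOfMem ι n σ).restrictNormal (ringClassField K ι m)).restrictScalars ℚ,
    restrictScalars_mem_ringClassGal ι m _⟩

/-- **The restriction is the same map on complex numbers**: for `x ∈ K[m]`,
`((restrictGal σ) x : ℂ) = (σ (inclusion x) : ℂ)`. [folklore] -/
theorem coe_restrictGal_apply (σ : ringClassGal ι n) (x : ringClassField K ι m) :
    (((restrictGal ι hK hmn hn σ).1 x : ringClassField K ι m) : ℂ) =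
      ((σ.1 (RingClassField.inclusion ι (ringClassField_mono hK ι hmn hn) x) :
        ringClassField K ι n) : ℂ) := by
  letI : Algebra (ringClassField K ι m) (ringClassField K ι n) :=
    (RingClassField.inclusion ι (ringClassField_mono hK ι hmn hn)).toRingHom.toAlgebra
  haveI : IsScalarTower K (ringClassField K ι m) (ringClassField K ι n) :=
    IsScalarTower.of_algebraMap_eq fun k =>
      ((RingClassField.inclusion ι (ringClassField_mono hK ι hmn hn)).commutes k).symm
  haveI := (finiteDimensional_and_isGalois_ringClassField hK ι (ne_zero_of_dvd hmn hn)).2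
  have h := AlgEquiv.restrictNormal_commutes (algEquivOfMem ι n σ) (ringClassField K ι m) x
  -- `h : algebraMap K[m] K[n] (res σ x) = σ (algebraMap K[m] K[n] x)`, and `algebraMap = inclusion`
  have halg : ∀ z : ringClassField K ι m,
      ((algebraMap (ringClassField K ι m) (ringClassField K ι n) z : ringClassField K ι n) : ℂ) =
        (z : ℂ) :=
    fun z => RingClassField.coe_inclusion ι (ringClassField_mono hK ι hmn hn) z
  have hdef : ((restrictGal ι hK hmn hn σ).1 x : ringClassField K ι m) =
      (algEquivOfMem ι n σ).restrictNormal (ringClassField K ι m) x := rfl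
  rw [hdef, ← halg ((algEquivOfMem ι n σ).restrictNormal (ringClassField K ι m) x), h]
  rfl

/-- **Compatibility with the Galois action on points**: for `P ∈ E(K[m])`, pushing forward along
`K[m] ⊆ K[n]` intertwines the restricted and the original automorphism:
`incl (res σ · P) = σ · (incl P)` in `E(K[n])`. [folklore] -/
theorem map_inclusion_pointGalHom_restrictGal (W : WeierstrassCurve ℚ) (σ : ringClassGal ι n)
    (P : (W.baseChange (ringClassField K ι m : Type)).toAffine.Point) :
    WeierstrassCurve.Affine.Point.map (W' := W)
        (RingClassField.inclusion ι (ringClassField_mono hK ι hmn hn)).toRingHom.toRatAlgHom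
        (pointGalHom W (ringClassField K ι m) (restrictGal ι hK hmn hn σ).1 P) =
      pointGalHom W (ringClassField K ι n) σ.1
        (WeierstrassCurve.Affine.Point.map (W' := W)
          (RingClassField.inclusion ι (ringClassField_mono hK ι hmn hn)).toRingHom.toRatAlgHom P) := by
  rw [pointGalHom_apply, pointGalHom_apply, WeierstrassCurve.Affine.Point.map_map,
    WeierstrassCurve.Affine.Point.map_map]
  have hcomp : (RingClassField.inclusion ι (ringClassField_mono hK ι hmn hn)).toRingHom.toRatAlgHom.comp
      ((restrictGal ι hK hmn hn σ).1 : ringClassField K ι m →ₐ[ℚ] ringClassField K ι m) =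
      (σ.1 : ringClassField K ι n →ₐ[ℚ] ringClassField K ι n).comp
        (RingClassField.inclusion ι (ringClassField_mono hK ι hmn hn)).toRingHom.toRatAlgHom := by
    apply AlgHom.ext
    intro x
    apply Subtype.ext
    change ((RingClassField.inclusion ι (ringClassField_mono hK ι hmn hn)
        ((restrictGal ι hK hmn hn σ).1 x) : ringClassField K ι n) : ℂ) =
      ((σ.1 (RingClassField.inclusion ι (ringClassField_mono hK ι hmn hn) x) :
        ringClassField K ι n) : ℂ)
    rw [RingClassField.coe_inclusion, coe_restrictGal_apply]
  rw [hcomp]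

end Restrict

end Summit.BirchSwinnertonDyer.Uniform.U2.RingClass

end
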